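import Mathlib
import HarnessLib

/-!
# Crux `NoZenoR` (stmt-ResolutionOfSingularities-19943), row 8⁗ — RECURRENT SYZYGIES: a module that is a
# retract of its own double syzygy and is not stably annihilated by `a` witnesses `a ∉ ca` in every degree

Route `ResolutionOfSingularities/HomologicalConductor`, chain W4.4, KERNEL-g18 §3 (lead g18, THEOREM 18.1).
`[OURS]` — AI-formalised, weaker than expert review; NOT a statement of any manuscript under review.

THEOREM 18.1 of KERNEL-g18: over `R = ⅟5(1,3,2)` the graded-indecomposable MCM module `C` (rank 8) is a direct
summand of `Ω²C` (the Ω-orbit of the cotangent module `cot_c4` closes on the 2-cycle `{C, C′}`), and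
`y₁y₃² ∉ sann(C)`; hence `y₁y₃² · Ext^{2m+1}(C, −) ≠ 0` for every `m`, so `y₁y₃²` lies in no `caᴺ(R)`, i.e.
`y₁y₃² ∉ ca(T₀)`. This file is the abstract skeleton of that inference, in an `R`-linear abelian category:
two short exact sequences `S₁ : K₁ → P₀ → X`, `S₂ : K₂ → P₁ → K₁'` with `P₀, P₁` projective and `K₁ ≅ K₁'`
(two steps of a projective resolution of `X`), a retraction `X → K₂ → X = 𝟙` («`X` is a direct summand of its
double syzygy»), and a scalar `a` with `a • [S₁] ≠ 0` («`a ∉ sann(X)`»):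

* `extClass_comp_injective_of_projective` — dimension shifting is injective: for `S : K → P → X` short exact with
  `P` projective, `x ↦ [S] ∘ x : Extⁿ⁺¹(K, Y) → Extⁿ⁺²(X, Y)` is injective (Mathlib `contravariant_sequence_exact₁`
  + `Ext.eq_zero_of_projective`);
* `exists_smul_ne_zero_odd_of_retract` — under the hypotheses above, for every `m` there is a class
  `e ∈ Ext^{2m+1}(X, K₁)` with `a • e ≠ 0`. In the model: `a · Ext^{2m+1}_R(C, −) ≠ 0` for all `m`, so `a ∉ caᴺ(R)`
  for every `N` (`caᴺ` kills ALL `Ext^{≥ N}`), i.e. `a ∉ ca(R)`.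

Nothing here is specific to `⅟5(1,3,2)`; the instance (`X = C`, `a = y₁y₃²`, the splitting `C | Ω²C`) is the
exact ℤ³-graded computation of KERNEL-g18 §3.1 (certificates HOME `engine-g18/pres18/`).
-/

noncomputable section

-- single-problem summit: the doubled namespace component is forced
set_option linter.dupNamespace false

open CategoryTheory CategoryTheory.Abelian CategoryTheory.Limits

universe w t v u

namespace Summit.ResolutionOfSingularities.ResolutionOfSingularities.Theorems.NoZeno.SyzygyRecurrence

variable {R : Type t} [Ring R] {C : Type u} [Category.{v} C] [Abelian C] [Linear R C] [HasExt.{w} C]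

/-- **Dimension shifting is injective in positive degrees.** For a short exact `S : K → P → X` with `P`
projective and `n ≥ 1`, precomposition with the class `[S] ∈ Ext¹(X, K)` is an injective map
`Extⁿ(K, Y) → Extⁿ⁺¹(X, Y)` (its kernel is the image of `Extⁿ(P, Y) = 0`). [folklore; Mathlib
`contravariant_sequence_exact₁`, `Ext.eq_zero_of_projective`] -/
theorem extClass_comp_injective_of_projective {S : ShortComplex C} (hS : S.ShortExact)
    [Projective S.X₂] (Y : C) {n₀ n₁ : ℕ} (hn : 1 + (n₀ + 1) = n₁) :
    Function.Injective fun x : Ext S.X₁ Y (n₀ + 1) => hS.extClass.comp x hn := by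
  have hker : ∀ x : Ext S.X₁ Y (n₀ + 1), hS.extClass.comp x hn = 0 → x = 0 := by
    intro x hx
    obtain ⟨x₂, rfl⟩ := Ext.contravariant_sequence_exact₁ hS Y x hn hx
    rw [Ext.eq_zero_of_projective x₂, Ext.comp_zero]
  intro x₁ x₂ h
  have h' : hS.extClass.comp (x₁ - x₂) hn = 0 := by
    simp only at h
    rw [sub_eq_add_neg, Ext.comp_add, Ext.comp_neg, h, add_neg_cancel]
  exact sub_eq_zero.mp (hker _ h')

/-- Scalars pass through dimension shifting: `a • ([S] ∘ x) = [S] ∘ (a • x)`. [folklore] -/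
theorem smul_extClass_comp {S : ShortComplex C} (hS : S.ShortExact) {Y : C} {n₀ n₁ : ℕ}
    (hn : 1 + n₀ = n₁) (a : R) (x : Ext S.X₁ Y n₀) :
    a • hS.extClass.comp x hn = hS.extClass.comp (a • x) hn := by
  rw [Ext.comp_smul]

/-- One shift: if `a • x ≠ 0` in `Extⁿ⁺¹(K, Y)` then `a • ([S] ∘ x) ≠ 0` in `Extⁿ⁺²(X, Y)`. [folklore] -/
theorem smul_extClass_comp_ne_zero {S : ShortComplex C} (hS : S.ShortExact) [Projective S.X₂] {Y : C}
    {n₀ n₁ : ℕ} (hn : 1 + (n₀ + 1) = n₁) (a : R) (x : Ext S.X₁ Y (n₀ + 1)) (hx : a • x ≠ 0) :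
    a • hS.extClass.comp x hn ≠ 0 := by
  intro h
  rw [smul_extClass_comp hS hn a x] at h
  have h0 : hS.extClass.comp (0 : Ext S.X₁ Y (n₀ + 1)) hn = 0 := Ext.comp_zero _ _ _ _ _
  exact hx (extClass_comp_injective_of_projective hS Y hn (h.trans h0.symm))

/-- Transport along a retraction: if `i ≫ r = 𝟙 X` and `a • e ≠ 0` for `e ∈ Extⁿ(X, Y)`, then
`a • (r ∘ e) ≠ 0` in `Extⁿ(K, Y)` (because `i ∘ (r ∘ e) = e`). [folklore] -/
theorem smul_mk₀_comp_ne_zero_of_retract {X K Y : C} (i : X ⟶ K) (r : K ⟶ X) (hir : i ≫ r = 𝟙 X)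
    {n : ℕ} (a : R) (e : Ext X Y n) (he : a • e ≠ 0) :
    a • (Ext.mk₀ r).comp e (zero_add n) ≠ 0 := by
  intro h
  apply he
  have : (Ext.mk₀ i).comp ((Ext.mk₀ r).comp e (zero_add n)) (zero_add n) = e := by
    rw [Ext.mk₀_comp_mk₀_assoc, hir, Ext.mk₀_id_comp]
  rw [← this, ← Ext.comp_smul, h, Ext.comp_zero]

/-- **Recurrent syzygies witness non-annihilation in every odd degree.** Let `S₁ : K₁ → P₀ → X` and
`S₂ : K₂ → P₁ → K₁'` be short exact with `P₀`, `P₁` projective and `φ : K₁ ≅ K₁'` (two steps of a projective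
resolution of `X`, so `K₂` is a double syzygy of `X`); suppose `X` is a retract of `K₂` (`i ≫ r = 𝟙`) and
`a • [S₁] ≠ 0` (`a` does not stably annihilate `X`). Then for every `m` there is `e ∈ Ext^{2m+1}(X, K₁)` with
`a • e ≠ 0`; in particular `a` annihilates `Ext^{≥ N}(X, −)` for NO `N`. Model: `X = C` over `⅟5(1,3,2)`,
`a = y₁y₃²` (KERNEL-g18 THEOREM 18.1: `C | Ω²C`, `y₁y₃² ∉ sann C` ⇒ `y₁y₃² ∉ ca`). [this work] -/
theorem exists_smul_ne_zero_odd_of_retract {S₁ S₂ : ShortComplex C} (hS₁ : S₁.ShortExact)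
    (hS₂ : S₂.ShortExact) [Projective S₁.X₂] [Projective S₂.X₂] (φ : S₁.X₁ ≅ S₂.X₃)
    (i : S₁.X₃ ⟶ S₂.X₁) (r : S₂.X₁ ⟶ S₁.X₃) (hir : i ≫ r = 𝟙 S₁.X₃) (a : R)
    (ha : a • hS₁.extClass ≠ 0) (m : ℕ) :
    ∃ e : Ext S₁.X₃ S₁.X₁ (2 * m + 1), a • e ≠ 0 := by
  induction m with
  | zero => exact ⟨hS₁.extClass, by simpa using ha⟩
  | succ m ih =>
    obtain ⟨e, he⟩ := ih
    -- move to the double syzygy along the retraction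
    have h₂ := smul_mk₀_comp_ne_zero_of_retract i r hir a e he
    -- shift along S₂ : degree 2m+1 ↦ 2m+2, values now on S₂.X₃ ≅ S₁.X₁
    have h₃ := smul_extClass_comp_ne_zero hS₂ (n₀ := 2 * m) (n₁ := 2 * m + 2) (by omega) a _ h₂
    -- transport along φ⁻¹ : S₂.X₃ → S₁.X₁ (precomposition with an isomorphism)
    set e₄ : Ext S₁.X₁ S₁.X₁ (2 * m + 2) := (Ext.mk₀ φ.hom).comp (hS₂.extClass.comp
        ((Ext.mk₀ r).comp e (zero_add _)) (show 1 + (2 * m + 1) = 2 * m + 2 by omega)) (zero_add _) with he₄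
    have h₄ : a • e₄ ≠ 0 := smul_mk₀_comp_ne_zero_of_retract φ.inv φ.hom φ.inv_hom_id a _ h₃
    -- shift along S₁ : degree 2m+2 ↦ 2m+3
    exact ⟨hS₁.extClass.comp e₄ (show 1 + (2 * m + 2) = 2 * (m + 1) + 1 by omega),
      smul_extClass_comp_ne_zero hS₁ (n₀ := 2 * m + 1) (n₁ := 2 * (m + 1) + 1) (by omega) a e₄ h₄⟩

end Summit.ResolutionOfSingularities.ResolutionOfSingularities.Theorems.NoZeno.SyzygyRecurrence

end
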